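import Literature.Geometry.Kaehler.ComplexTorusEllipticProductNeronSeveriGraphs
import Literature.Geometry.Kaehler.ComplexTorusEllipticSelfProductAmpleCone
import HarnessLib

/-!
# Ample classes on a product of elliptic curves `E × E'`: Rosen–Shnidman's Prop. 2.2 (`L` ample iff `L² > 0`,
# `L · (h + v) > 0`), §3 (`d(ah + bv) = ab`, Prop. 3.1, Thm. 3.2 (1) `N(A, d) = σ₀(d)`), §4 (Lemma 4.1,
# `det = 2m`, the quadratic form `q_L([y], xλ) = amx² - 2bmxy + cy² = deg f^*L`, Thm. 4.2 (1)–(2))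

Layer `Literature/Geometry/Kaehler`, namespace `Literature.Geometry.Kaehler.ComplexTorus`; lane `lit-hodgefound`, seat
p07 (generation 50), file 85 of the seat lineage.  Sequel of file 84 (`ComplexTorusEllipticProductNeronSeveriGraphs`:
Prop. 2.3 `NS(E × E') ≅ ℤ ⊕ Hom(E, E') ⊕ ℤ` through the curves `h = E × {0}`, `v = {0} × E'`, `Γ_λ`, their pointwise
Néron–Severi forms `θ_h, θ_v, θ_Γ`, Rosen–Shnidman's `X_λ = [Γ_λ] - h - mv`, the intersection table and
`(ah + bX_λ + cv)² = 2(ac - b²m)`) and of file 71 (`ComplexTorusEllipticSelfProductAmpleCone`: the open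
Nakai–Moishezon criterion of an abelian surface `IsRiemannForm.isRiemannForm_iff_intersectionForm_self_pos_and_pos`
— `L` ample iff `L² > 0 ∧ L · H > 0` — and `intersectionForm_pos_iff_of_self_pos`: the nappe of `{L² > 0}` may be
selected by any `(1,1)`-class of positive square pairing positively with `H`), both consumed BY NAME together with
`SubtorusFrame.intersectionForm_pos_of_analyticCycleClass_eq` (curves pair positively with polarisations),
`isSimple_and_isAbelianVariety_of_finrank_eq_one` / `IsAbelianVariety.prodL2` (`E × E'` is an abelian surface),
`torusIntegral_volumeForm` (`∫_E vol_E = 1`).  Theorems only (no definition, no named fact, no instance, no notation;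
net Literature debt `0`).

THE SOURCE, VERBATIM.  J. Rosen, A. Shnidman, *Néron–Severi groups of product abelian surfaces* (2014), held
`paper:arxiv-1402.2233`.  §2 Prop. 2.2 (p0006): "Suppose `A = E × E'` is a product of two elliptic curves and let
`h, v ∈ NS(A)` be the two axes. Then `L ∈ Pic(X)` is ample if and only if `L.L > 0` and `L.(h+v) > 0`."  §3 (p0008):
"In this case, `NS(A) = ℤh + ℤv` … If `L ≡ ah + bv`, then the degree of `L` is `d(L) = ½ L.L = ab`.", Prop. 3.1:
"`L ≡ ah + bv ∈ NS(A)` is ample if and only if `a` and `b` are both positive.", Thm. 3.2: "If `A` is a product of two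
non-isogenous elliptic curves, then `N(A,d) = σ_0(d)` …", proof: "Note that `Aut(A) ≅ ℤ/2 × ℤ/2` acts trivially on
`NS(A)`."  §4 (p0009): "The class `X_λ` is orthogonal to `h` and `v` and if `L ≡ ah + bX_λ + cv`, then the degree
of `L` is `d = ½(L.L) = ac − b²m`.", "Note that the determinant of the intersection pairing on `NS(A)` is equal to
`2m`", Lemma 4.1: "`L` is ample if and only if `d > 0` and `a, c > 0`. Proof. This follows from Proposition
(nakai).", "Associated with the class `L ≡ ah + bX_λ + cv ∈ NS(A)` is the quadratic form `q_L : Hom(E, A_m) → ℤ`,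
`f ↦ deg(f^*L)`. Using the natural basis `{(1,0), (0,λ)}` for `Hom(E, A_m) = Hom(E, E) ⊕ Hom(E, E')`, one computes
`q_L([y], xλ) = amx² − 2bmxy + cy²`.", Thm. 4.2 (p0010): "`L` is ample if and only if `q_L` is positive definite.
The discriminant of `q_L` is `−4m deg(L)`".

THE MODEL is that of file 84 (read its docstring): `E = F₁/Ψ₁(ℤ^{κ₁})`, `E' = F₂/Ψ₂(ℤ^{κ₂})` one-dimensional
complex tori with positively oriented lattice enumerations `e₁, e₂` (`vol_E = volumeForm Ψ₁ e₁`, `∫_E vol_E = 1`,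
`vol_E = [pt]`), `E × E' = ComplexTorus (prodPeriodL2 Ψ₁ Ψ₂)` with positively oriented `e`, `Q = intersectionForm
(g := 2) (prodPeriodL2 Ψ₁ Ψ₂) e`; the HYPOTHESES CONVENTION of file 84: `Zh, Zv, ZΓ` are sub-torus data presenting
`h`, `v`, `Γ_λ` (`λ = (A, L)`, `hA`), `ah av aΓ` translation vectors, `θh θv θΓ` THE Néron–Severi forms of their
classes (`[Z] = ofRealForm (−θ_Z)`), `m = deg λ = Nat.card (mapMatrixHom Ψ₁ Ψ₂ A).ker`, `X_λ = θΓ − θh − m θv`.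
"AMPLE" = the tree's `IsRiemannForm` (type `(1,1)`, integral, positive definite hermitian form: a polarisation);
"`d(L) = ½ L.L`" is read as `Q(θ, θ) = 2d`; `Hom(E, E') = 0` (non-isogenous) is the hypothesis that every integer
matrix with an analytic representation vanishes; `N(A, d)` = the number (`Set.ncard`) of polarisations `θ` with
`Q(θ, θ) = 2d` (the source counts modulo `Aut(A) = ℤ/2 × ℤ/2`, which acts trivially on `NS(A)`).

CONTENTS.
* §0 (private) `dim_ℂ Fᵢ = 1`, pairs, `ℤ`-combinations of NS forms; `isAbelianVariety_prodPeriodL2_of_equiv`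
  (`E × E'` is an abelian surface).
* §1 PROP. 2.2: `intersectionForm_axes_add_axes` (`(h + v)² = 2`, `(h + v) · h = (h + v) · v = 1`),
  `intersectionForm_axes_add_axes_pos` (`(h + v) · H > 0` for every polarisation `H`),
  **`IsNSForm.isRiemannForm_iff_intersectionForm_self_pos_and_axes_pos`** ("`L` is ample iff `L.L > 0` and
  `L.(h + v) > 0`"), `isRiemannForm_axes_add_axes` (`h + v` is a (principal) polarisation).
* §2 (§3 of the source): `intersectionForm_smul_axes_add_smul_axes` (`(ah + bv)² = 2ab`, `· h = b`, `· v = a`,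
  `· (h + v) = a + b`), `isNSForm_smul_axes_add_smul_axes`, **`isRiemannForm_smul_axes_add_smul_axes_iff`** (PROP. 3.1:
  ample iff `a, b > 0`), **`ncard_setOf_isRiemannForm_and_intersectionForm_self_eq_card_divisors`** (THM. 3.2 (1):
  for `Hom(E, E') = 0`, `N(A, d) = σ₀(d)` — the polarisations of degree `d` are the `kh + (d/k)v`, `k ∣ d`).
* §3 (§4 of the source): `intersectionForm_smul_add_smul_graph_sub_add_smul` (`L · h = c`, `L · v = a`,
  `L · X_λ = −2bm`, `L · (h + v) = a + c` for `L = ah + bX_λ + cv`), **`det_gram_axes_graph_sub`** (the Gram matrix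
  of `h, X_λ, v` is `[[0,0,1],[0,−2m,0],[1,0,0]]`, "determinant `2m`"), `isNSForm_smul_add_smul_graph_sub_add_smul`,
  **`isRiemannForm_smul_add_smul_graph_sub_add_smul_iff`** (LEMMA 4.1: ample iff `ac − b²m > 0 ∧ a > 0 ∧ c > 0`, for
  EVERY `λ` on every `E × E'`), **`isRiemannForm_smul_add_smul_graph_sub_add_smul_iff_posDef`** (THM. 4.2 (1)–(2) for
  `m ≥ 1`: ample iff `[am, −2bm, c]` is positive definite, `disc = −4m(ac − b²m)`), `isRiemannForm_rosenShnidman_iff`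
  (in the coordinates of Prop. 2.3: `(a−1)h + Γ_λ + (b−m)v` ample iff `ab − m > 0 ∧ a, b > 0`).
* §4 THE QUADRATIC FORM `q_L`: for the real-linear lift `f : u ↦ (y u, x L u)` of `([y], xλ) : E → E × E'`
  (`exists_clm_apply_eq_toLp_smul`: it exists and, for integers `x, y`, maps `Λ_E` into `Λ_{E×E'}`),
  **`smul_add_smul_graph_sub_add_smul_comp_apply`** (`(f^*L)(u, w) = −(amx² − 2bmxy + cy²) Re vol_E(u, w)`),
  **`ofRealForm_neg_smul_add_smul_graph_sub_add_smul_comp`** (`c₁(f^*L) = q_L(f) · vol_E = q_L(f) · [pt]`),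
  **`torusIntegral_ofRealForm_neg_smul_add_smul_graph_sub_add_smul_comp`** (`deg f^*L = ∫_E c₁(f^*L) =
  amx² − 2bmxy + cy²`).
Scope: Thm. 3.2 (2)–(3), Thm. 3.3 and Thm. 4.2 (3)–(4) involve smoothness / very ampleness of `|L|` (Reider's theorem)
and `Γ₀(m)`-equivariance, not formalised here — TODO(general form).

## References

* [RosenShnidman2014NeronSeveriProductSurfaces] J. Rosen, A. Shnidman, *Néron–Severi groups of product abelian
  surfaces*, arXiv:1402.2233 (2014), §2 Prop. 2.2 (p. 6), §3 Prop. 3.1, Thm. 3.2 (p. 8), §4 Lemma 4.1, Thm. 4.2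
  (pp. 9–10).
* [KollarMori1998] J. Kollár, S. Mori, *Birational Geometry of Algebraic Varieties*, Cambridge (1998), §II.4
  Cor. 1.21 and Example 1.23 (2).
* [Lange2023AbelianVarietiesComplex] H. Lange, *Abelian Varieties over the Complex Numbers*, Springer (2023), §2.2
  Cor. 2.2.3 (Nakai–Moishezon), §2.4 Cor. 2.4.24, §6.2.4 (p. 310).
-/

noncomputable section

set_option maxSynthPendingDepth 3

open scoped Manifold ComplexOrder NNReal InnerProductSpace
open Complex Set Function Module WithLp

namespace Literature.Geometry.Kaehler

namespace ComplexTorus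

universe u

section Pairs

variable {V W : Type*} [NormedAddCommGroup V] [NormedSpace ℝ V] [NormedAddCommGroup W] [NormedSpace ℝ W]
  (γ : V [⋀^Fin 2]→L[ℝ] W)

/-- `γ(x, y) = -γ(y, x)`. [folklore] -/
private theorem pair_swap₈₅ (x y : V) : γ ![x, y] = -γ ![y, x] := by
  have h := γ.toAlternatingMap.map_swap ![y, x] (show (0 : Fin 2) ≠ 1 by decide)
  have e : (![y, x] ∘ Equiv.swap (0 : Fin 2) 1) = ![x, y] := by
    funext i; fin_cases i <;> rfl
  rw [e] at h
  exact h

/-- `γ(r • x, y) = r • γ(x, y)`. [folklore] -/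
private theorem pair_smul_left₈₅ (r : ℝ) (x y : V) : γ ![r • x, y] = r • γ ![x, y] :=
  γ.toContinuousMultilinearMap.cons_smul ![y] r x

/-- `γ(x, r • y) = r • γ(x, y)`. [folklore] -/
private theorem pair_smul_right₈₅ (r : ℝ) (x y : V) : γ ![x, r • y] = r • γ ![x, y] := by
  rw [pair_swap₈₅ γ x, pair_smul_left₈₅, ← smul_neg, ← pair_swap₈₅]

/-- A `2`-form on its argument pair. [folklore] -/
private theorem apply_eq_pair₈₅ (v : Fin 2 → V) : γ v = γ ![v 0, v 1] := by
  congr 1; funext i; fin_cases i <;> rfl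

end Pairs

section Setting

variable {κ₁ κ₂ : Type*} [Fintype κ₁] [Fintype κ₂] [DecidableEq κ₁] [DecidableEq κ₂] {F₁ F₂ : Type u}
  [NormedAddCommGroup F₁] [InnerProductSpace ℂ F₁] [FiniteDimensional ℂ F₁] [MeasurableSpace F₁] [BorelSpace F₁]
  [NormedAddCommGroup F₂] [InnerProductSpace ℂ F₂] [FiniteDimensional ℂ F₂] [MeasurableSpace F₂] [BorelSpace F₂]
  (Ψ₁ : (κ₁ → ℝ) ≃L[ℝ] F₁) (Ψ₂ : (κ₂ → ℝ) ≃L[ℝ] F₂)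
  (e₁ : Fin (2 * 1) ≃ κ₁) (he₁ : orientationSign Ψ₁ e₁ = 1) (e₂ : Fin (2 * 1) ≃ κ₂) (he₂ : orientationSign Ψ₂ e₂ = 1)
  (e : Fin (2 * 2) ≃ κ₁ ⊕ κ₂) (he : orientationSign (prodPeriodL2 Ψ₁ Ψ₂) e = 1)
  (Zh Zv : SubtorusFrame (prodPeriodL2 Ψ₁ Ψ₂) (2 * 1))
  (hZh : Zh.carrier 0 = {t | (prodHomeomorphL2 Ψ₁ Ψ₂ t).2 = 0})
  (hZv : Zv.carrier 0 = {t | (prodHomeomorphL2 Ψ₁ Ψ₂ t).1 = 0})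
  (ah av : WithLp 2 (F₁ × F₂)) {θh θv : WithLp 2 (F₁ × F₂) [⋀^Fin 2]→L[ℝ] ℝ}
  (hθh : analyticCycleClass (prodPeriodL2 Ψ₁ Ψ₂) e (show 2 * 1 + 2 * 1 = 2 * 2 from rfl) (Zh.hasPureDim_carrier ah) =
    ofRealForm (-θh))
  (hθv : analyticCycleClass (prodPeriodL2 Ψ₁ Ψ₂) e (show 2 * 1 + 2 * 1 = 2 * 2 from rfl) (Zv.hasPureDim_carrier av) =
    ofRealForm (-θv))
  {L : F₁ →L[ℂ] F₂} (A : Matrix κ₂ κ₁ ℤ) (hA : ∀ x : κ₁ → ℝ, Ψ₂ ((A.map (Int.cast : ℤ → ℝ)).mulVec x) = L (Ψ₁ x))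
  (ZΓ : SubtorusFrame (prodPeriodL2 Ψ₁ Ψ₂) (2 * 1))
  (hZΓ : ZΓ.carrier 0 = {t | (prodHomeomorphL2 Ψ₁ Ψ₂ t).2 = mapMatrix Ψ₁ Ψ₂ A (prodHomeomorphL2 Ψ₁ Ψ₂ t).1})
  (aΓ : WithLp 2 (F₁ × F₂)) {θΓ : WithLp 2 (F₁ × F₂) [⋀^Fin 2]→L[ℝ] ℝ}
  (hθΓ : analyticCycleClass (prodPeriodL2 Ψ₁ Ψ₂) e (show 2 * 1 + 2 * 1 = 2 * 2 from rfl) (ZΓ.hasPureDim_carrier aΓ) =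
    ofRealForm (-θΓ))

/-! ## §0 Toolkit -/

omit [DecidableEq κ₁] [FiniteDimensional ℂ F₁] [MeasurableSpace F₁] [BorelSpace F₁] in
include Ψ₁ e₁ in
/-- `dim_ℂ F₁ = 1` when `rk Λ₁ = 2`. [cite: Lange2023AbelianVarietiesComplex, §1.1.1] -/
private theorem finrank_eq_one₈₅ : finrank ℂ F₁ = 1 := by
  have h := finrank_complex_mul_two Ψ₁ e₁
  omega

omit [FiniteDimensional ℂ F₁] [MeasurableSpace F₁] [BorelSpace F₁] [FiniteDimensional ℂ F₂] [MeasurableSpace F₂]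
  [BorelSpace F₂] in
include e₁ e₂ in
/-- **`E × E'` is an abelian surface** (both factors are elliptic curves, i.e. polarised; the product polarisation).
[cite: Lange2023AbelianVarietiesComplex, §2.4 Cor. 2.4.24] [cite: RosenShnidman2014NeronSeveriProductSurfaces, §2 ("abelian surface `A = E × E'`")] -/
theorem isAbelianVariety_prodPeriodL2_of_equiv : IsAbelianVariety (prodPeriodL2 Ψ₁ Ψ₂) :=
  (isSimple_and_isAbelianVariety_of_finrank_eq_one Ψ₁ (finrank_eq_one₈₅ Ψ₁ e₁)).2.2.1.prodL2 Ψ₁ Ψ₂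
    (isSimple_and_isAbelianVariety_of_finrank_eq_one Ψ₂ (finrank_eq_one₈₅ Ψ₂ e₂)).2.2.1

include he in
/-- The real form presenting the class of (a translate of) a curve datum is a Néron–Severi form.
[cite: Lange2023AbelianVarietiesComplex, §1.2.2 Prop. 1.2.9 and §2.2.1] -/
private theorem isNSForm_of_analyticCycleClass_eq₈₅ (Z : SubtorusFrame (prodPeriodL2 Ψ₁ Ψ₂) (2 * 1))
    (a : WithLp 2 (F₁ × F₂)) {θ : WithLp 2 (F₁ × F₂) [⋀^Fin 2]→L[ℝ] ℝ}
    (hθ : analyticCycleClass (prodPeriodL2 Ψ₁ Ψ₂) e (show 2 * 1 + 2 * 1 = 2 * 2 from rfl) (Z.hasPureDim_carrier a) =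
      ofRealForm (-θ)) :
    IsNSForm (prodPeriodL2 Ψ₁ Ψ₂) θ := by
  obtain ⟨θ₀, hNS, -, hcl, -, -⟩ :=
    exists_isNSForm_re_analyticCyclePeriod_eq_intersectionForm (prodPeriodL2 Ψ₁ Ψ₂) e he (Z.hasPureDim_carrier a)
  have hθ₀ : θ₀ = θ := neg_injective (ofRealForm_injective (hcl.symm.trans hθ))
  exact hθ₀ ▸ hNS

omit [DecidableEq κ₁] [DecidableEq κ₂] [FiniteDimensional ℂ F₁] [MeasurableSpace F₁] [BorelSpace F₁]
  [FiniteDimensional ℂ F₂] [MeasurableSpace F₂] [BorelSpace F₂] in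
/-- Integral combinations of Néron–Severi forms are Néron–Severi forms. [cite: Lange2023AbelianVarietiesComplex, §1.3.1 (`NS(X)` is a group)] -/
private theorem isNSForm_int_smul_add₈₅ {α β γ : WithLp 2 (F₁ × F₂) [⋀^Fin 2]→L[ℝ] ℝ} (hα : IsNSForm (prodPeriodL2 Ψ₁ Ψ₂) α)
    (hβ : IsNSForm (prodPeriodL2 Ψ₁ Ψ₂) β) (hγ : IsNSForm (prodPeriodL2 Ψ₁ Ψ₂) γ) (a b c : ℤ) :
    IsNSForm (prodPeriodL2 Ψ₁ Ψ₂) ((a : ℝ) • α + (b : ℝ) • β + (c : ℝ) • γ) := by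
  rw [← mem_neronSeveriGroup_iff (prodPeriodL2 Ψ₁ Ψ₂)] at hα hβ hγ ⊢
  rw [Int.cast_smul_eq_zsmul, Int.cast_smul_eq_zsmul, Int.cast_smul_eq_zsmul]
  exact add_mem (add_mem (AddSubgroup.zsmul_mem _ hα _) (AddSubgroup.zsmul_mem _ hβ _)) (AddSubgroup.zsmul_mem _ hγ _)

/-! ## §1 Rosen–Shnidman Prop. 2.2: `L` is ample iff `L · L > 0` and `L · (h + v) > 0` -/

include he hZh hZv hθh hθv in
/-- **`(h + v)² = 2`, `(h + v) · h = (h + v) · v = 1`.** [cite: RosenShnidman2014NeronSeveriProductSurfaces, §2 Prop. 2.2 and §3 ("`d(L) = ½ L.L = ab`" with `a = b = 1`)] -/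
theorem intersectionForm_axes_add_axes :
    intersectionForm (g := 2) (prodPeriodL2 Ψ₁ Ψ₂) e (θh + θv) (θh + θv) = 2 ∧
      intersectionForm (g := 2) (prodPeriodL2 Ψ₁ Ψ₂) e (θh + θv) θh = 1 ∧
        intersectionForm (g := 2) (prodPeriodL2 Ψ₁ Ψ₂) e (θh + θv) θv = 1 := by
  obtain ⟨hhh, hvv, hhv⟩ := intersectionForm_axes Ψ₁ Ψ₂ e he Zh Zv hZh hZv ah av hθh hθv
  have hvh : intersectionForm (g := 2) (prodPeriodL2 Ψ₁ Ψ₂) e θv θh = 1 := by rw [intersectionForm_comm _ even_two e, hhv]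
  simp only [map_add, LinearMap.add_apply, hhh, hvv, hhv, hvh]
  norm_num

include he hθh hθv in
/-- **`(h + v) · H > 0` for every polarisation `H`** (curves pair positively with ample classes).
[cite: KollarMori1998, §II.4 Cor. 1.21 and Ex. 1.23 (2)] [cite: RosenShnidman2014NeronSeveriProductSurfaces, §2 Prop. 2.2] -/
theorem intersectionForm_axes_add_axes_pos {η : WithLp 2 (F₁ × F₂) [⋀^Fin 2]→L[ℝ] ℝ}
    (hη : IsRiemannForm (prodPeriodL2 Ψ₁ Ψ₂) η) : 0 < intersectionForm (g := 2) (prodPeriodL2 Ψ₁ Ψ₂) e (θh + θv) η := by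
  have p₁ := SubtorusFrame.intersectionForm_pos_of_analyticCycleClass_eq (prodPeriodL2 Ψ₁ Ψ₂) e hη he Zh ah hθh
  have p₂ := SubtorusFrame.intersectionForm_pos_of_analyticCycleClass_eq (prodPeriodL2 Ψ₁ Ψ₂) e hη he Zv av hθv
  rw [map_add, LinearMap.add_apply]
  positivity

include e₁ e₂ he hZh hZv hθh hθv in
/-- **ROSEN–SHNIDMAN PROP. 2.2 (the ample cone of `E × E'`)**: "Suppose `A = E × E'` is a product of two elliptic
curves and let `h, v ∈ NS(A)` be the two axes. Then `L ∈ Pic(A)` is ample if and only if `L.L > 0` and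
`L.(h + v) > 0`."  Here: a Néron–Severi form `θ` of `E × E'` is a polarisation (`IsRiemannForm`: its hermitian form
is positive definite) iff `Q(θ, θ) > 0` and `Q(θ, θ_h + θ_v) > 0` — the open Nakai–Moishezon criterion of an abelian
surface (file 71, `Q⁺` is the ample cone) with the nappe selected by the class `h + v` of square `2`, which pairs
positively with every polarisation. [cite: RosenShnidman2014NeronSeveriProductSurfaces, §2 Prop. 2.2] [cite: KollarMori1998, §II.4 Cor. 1.21 and Ex. 1.23 (2)]
[cite: Lange2023AbelianVarietiesComplex, §2.2 Cor. 2.2.3 (Nakai–Moishezon)] -/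
theorem IsNSForm.isRiemannForm_iff_intersectionForm_self_pos_and_axes_pos {θ : WithLp 2 (F₁ × F₂) [⋀^Fin 2]→L[ℝ] ℝ}
    (hθ : IsNSForm (prodPeriodL2 Ψ₁ Ψ₂) θ) :
    IsRiemannForm (prodPeriodL2 Ψ₁ Ψ₂) θ ↔
      0 < intersectionForm (g := 2) (prodPeriodL2 Ψ₁ Ψ₂) e θ θ ∧
        0 < intersectionForm (g := 2) (prodPeriodL2 Ψ₁ Ψ₂) e θ (θh + θv) := by
  obtain ⟨η, hη⟩ := isAbelianVariety_prodPeriodL2_of_equiv Ψ₁ Ψ₂ e₁ e₂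
  have hh : IsNSForm (prodPeriodL2 Ψ₁ Ψ₂) (θh + θv) :=
    (isNSForm_of_analyticCycleClass_eq₈₅ Ψ₁ Ψ₂ e he Zh ah hθh).add (isNSForm_of_analyticCycleClass_eq₈₅ Ψ₁ Ψ₂ e he Zv av hθv)
  have hhh : 0 < intersectionForm (g := 2) (prodPeriodL2 Ψ₁ Ψ₂) e (θh + θv) (θh + θv) := by
    rw [(intersectionForm_axes_add_axes Ψ₁ Ψ₂ e he Zh Zv hZh hZv ah av hθh hθv).1]; norm_num
  have hhη := intersectionForm_axes_add_axes_pos Ψ₁ Ψ₂ e he Zh Zv ah av hθh hθv hη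
  rw [hη.isRiemannForm_iff_intersectionForm_self_pos_and_pos (prodPeriodL2 Ψ₁ Ψ₂) e hθ]
  constructor
  · rintro ⟨hθθ, hθη⟩
    exact ⟨hθθ, (intersectionForm_pos_iff_of_self_pos (prodPeriodL2 Ψ₁ Ψ₂) e hη.1 hη.2.2 hh.type_one_one hhh hhη
      hθ.type_one_one hθθ).1 hθη⟩
  · rintro ⟨hθθ, hθh⟩
    exact ⟨hθθ, (intersectionForm_pos_iff_of_self_pos (prodPeriodL2 Ψ₁ Ψ₂) e hη.1 hη.2.2 hh.type_one_one hhh hhη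
      hθ.type_one_one hθθ).2 hθh⟩

include e₁ e₂ he hZh hZv hθh hθv in
/-- **`h + v` is ample** (the product principal polarisation of `E × E'`: `(h + v)² = 2 > 0`).
[cite: RosenShnidman2014NeronSeveriProductSurfaces, §2 Prop. 2.4 ("`(E × E', h + d₂ v)`" polarized) and §3 Prop. 3.1] -/
theorem isRiemannForm_axes_add_axes : IsRiemannForm (prodPeriodL2 Ψ₁ Ψ₂) (θh + θv) := by
  have hh : IsNSForm (prodPeriodL2 Ψ₁ Ψ₂) (θh + θv) :=
    (isNSForm_of_analyticCycleClass_eq₈₅ Ψ₁ Ψ₂ e he Zh ah hθh).add (isNSForm_of_analyticCycleClass_eq₈₅ Ψ₁ Ψ₂ e he Zv av hθv)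
  have h2 := (intersectionForm_axes_add_axes Ψ₁ Ψ₂ e he Zh Zv hZh hZv ah av hθh hθv).1
  rw [hh.isRiemannForm_iff_intersectionForm_self_pos_and_axes_pos Ψ₁ Ψ₂ e₁ e₂ e he Zh Zv hZh hZv ah av hθh hθv, h2]
  norm_num

/-! ## §2 Rosen–Shnidman §3: the classes `ah + bv` — `d(L) = ab`, ample iff `a, b > 0` -/

include he hZh hZv hθh hθv in
/-- **`L = ah + bv`: `L² = 2ab` ("`d(L) = ½ L.L = ab`"), `L · h = b`, `L · v = a`, `L · (h + v) = a + b`.**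
[cite: RosenShnidman2014NeronSeveriProductSurfaces, §3 ("If `L ≡ ah + bv`, then the degree of `L` is `d(L) = ½ L.L = ab`")] -/
theorem intersectionForm_smul_axes_add_smul_axes (a b : ℝ) :
    intersectionForm (g := 2) (prodPeriodL2 Ψ₁ Ψ₂) e (a • θh + b • θv) (a • θh + b • θv) = 2 * (a * b) ∧
      intersectionForm (g := 2) (prodPeriodL2 Ψ₁ Ψ₂) e (a • θh + b • θv) θh = b ∧
        intersectionForm (g := 2) (prodPeriodL2 Ψ₁ Ψ₂) e (a • θh + b • θv) θv = a ∧
          intersectionForm (g := 2) (prodPeriodL2 Ψ₁ Ψ₂) e (a • θh + b • θv) (θh + θv) = a + b := by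
  obtain ⟨hhh, hvv, hhv⟩ := intersectionForm_axes Ψ₁ Ψ₂ e he Zh Zv hZh hZv ah av hθh hθv
  have hvh : intersectionForm (g := 2) (prodPeriodL2 Ψ₁ Ψ₂) e θv θh = 1 := by rw [intersectionForm_comm _ even_two e, hhv]
  simp only [map_add, map_smul, LinearMap.add_apply, LinearMap.smul_apply, smul_eq_mul, hhh, hvv, hhv, hvh]
  refine ⟨by ring, by ring, by ring, by ring⟩

include he hθh hθv in
/-- `ah + bv ∈ NS(E × E')` for integers `a, b`. [cite: RosenShnidman2014NeronSeveriProductSurfaces, §3 ("`NS(A) = ℤh + ℤv`" when `Hom(E, E') = 0`)] -/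
theorem isNSForm_smul_axes_add_smul_axes (a b : ℤ) : IsNSForm (prodPeriodL2 Ψ₁ Ψ₂) ((a : ℝ) • θh + (b : ℝ) • θv) := by
  have h := isNSForm_int_smul_add₈₅ Ψ₁ Ψ₂ (isNSForm_of_analyticCycleClass_eq₈₅ Ψ₁ Ψ₂ e he Zh ah hθh)
    (isNSForm_of_analyticCycleClass_eq₈₅ Ψ₁ Ψ₂ e he Zv av hθv) (isNSForm_of_analyticCycleClass_eq₈₅ Ψ₁ Ψ₂ e he Zv av hθv)
    a b 0
  simpa using h

include e₁ e₂ he hZh hZv hθh hθv in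
/-- **ROSEN–SHNIDMAN PROP. 3.1: "`L ≡ ah + bv ∈ NS(A)` is ample if and only if `a` and `b` are both positive"**
(for every product `E × E'`; when `E`, `E'` are not isogenous these are all classes).
[cite: RosenShnidman2014NeronSeveriProductSurfaces, §3 Prop. 3.1] -/
theorem isRiemannForm_smul_axes_add_smul_axes_iff (a b : ℤ) :
    IsRiemannForm (prodPeriodL2 Ψ₁ Ψ₂) ((a : ℝ) • θh + (b : ℝ) • θv) ↔ 0 < a ∧ 0 < b := by
  rw [(isNSForm_smul_axes_add_smul_axes Ψ₁ Ψ₂ e he Zh Zv ah av hθh hθv a b).isRiemannForm_iff_intersectionForm_self_pos_and_axes_pos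
      Ψ₁ Ψ₂ e₁ e₂ e he Zh Zv hZh hZv ah av hθh hθv,
    (intersectionForm_smul_axes_add_smul_axes Ψ₁ Ψ₂ e he Zh Zv hZh hZv ah av hθh hθv a b).1,
    (intersectionForm_smul_axes_add_smul_axes Ψ₁ Ψ₂ e he Zh Zv hZh hZv ah av hθh hθv a b).2.2.2]
  constructor
  · rintro ⟨h1, h2⟩
    have h1' : (0 : ℝ) < a * b := by linarith
    have hab : (0 : ℤ) < a * b := by exact_mod_cast h1'
    have hs : (0 : ℤ) < a + b := by exact_mod_cast h2
    rcases lt_trichotomy a 0 with ha | ha | ha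
    · have hb : b < 0 := by
        by_contra hb; push Not at hb
        nlinarith
      omega
    · subst ha; simp at hab
    · exact ⟨ha, pos_of_mul_pos_right hab ha.le⟩
  · rintro ⟨ha, hb⟩
    have ha' : (0 : ℝ) < a := by exact_mod_cast ha
    have hb' : (0 : ℝ) < b := by exact_mod_cast hb
    exact ⟨by positivity, by positivity⟩

include e₁ e₂ he₁ he₂ he hZh hZv hθh hθv in
/-- **ROSEN–SHNIDMAN THM. 3.2 (1): "If `A` is a product of two non-isogenous elliptic curves, then
`N(A, d) = σ₀(d)`"** — the number of polarisations of degree `d` (`d(L) = ½ L.L`; `Aut(A) = ℤ/2 × ℤ/2` acts trivially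
on `NS(A)`, so no quotient is needed) is the number of divisors of `d`: when `Hom(E, E') = 0` every class is
`ah + bv` (§3 of the source; file 84's `rosenShnidman_surjective` with `λ = 0`, `Γ_0 = h`), ample iff `a, b > 0`
(Prop. 3.1), of degree `ab`; the polarisations of degree `d` are the `kh + (d/k)v`, `k ∣ d`.
[cite: RosenShnidman2014NeronSeveriProductSurfaces, §3 Thm. 3.2 ("`N(A,d) = σ_0(d)`")] -/
theorem ncard_setOf_isRiemannForm_and_intersectionForm_self_eq_card_divisors
    (hHom : ∀ (B : Matrix κ₂ κ₁ ℤ) (M : F₁ →L[ℂ] F₂),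
      (∀ x : κ₁ → ℝ, Ψ₂ ((B.map (Int.cast : ℤ → ℝ)).mulVec x) = M (Ψ₁ x)) → B = 0) (d : ℕ) :
    {θ : WithLp 2 (F₁ × F₂) [⋀^Fin 2]→L[ℝ] ℝ | IsRiemannForm (prodPeriodL2 Ψ₁ Ψ₂) θ ∧
        intersectionForm (g := 2) (prodPeriodL2 Ψ₁ Ψ₂) e θ θ = 2 * d}.ncard = (Nat.divisors d).card := by
  classical
  set φ : ℕ → WithLp 2 (F₁ × F₂) [⋀^Fin 2]→L[ℝ] ℝ :=
    fun k ↦ ((k : ℤ) : ℝ) • θh + (((d / k : ℕ) : ℤ) : ℝ) • θv with hφ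
  have hamp := isRiemannForm_smul_axes_add_smul_axes_iff Ψ₁ Ψ₂ e₁ e₂ e he Zh Zv hZh hZv ah av hθh hθv
  have hQ := intersectionForm_smul_axes_add_smul_axes Ψ₁ Ψ₂ e he Zh Zv hZh hZv ah av hθh hθv
  have hS : {θ : WithLp 2 (F₁ × F₂) [⋀^Fin 2]→L[ℝ] ℝ | IsRiemannForm (prodPeriodL2 Ψ₁ Ψ₂) θ ∧
      intersectionForm (g := 2) (prodPeriodL2 Ψ₁ Ψ₂) e θ θ = 2 * d} = φ '' (Nat.divisors d : Set ℕ) := by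
    ext θ
    simp only [Set.mem_setOf_eq, Set.mem_image, Finset.mem_coe, Nat.mem_divisors]
    constructor
    · rintro ⟨hR, hQθ⟩
      obtain ⟨a, b, B, M, hB, hrep⟩ :=
        rosenShnidman_surjective Ψ₁ Ψ₂ e₁ he₁ e₂ he₂ e he Zh Zv hZh hZv ah av hθh hθv hR.isNSForm
      obtain rfl : B = 0 := hHom B M hB
      have hrep' := hrep Zh (hZh.trans (setOf_snd_eq_zero_eq_setOf_graph_zero Ψ₁ Ψ₂)) ah θh hθh
      set b' : ℤ := b - (Nat.card (mapMatrixHom Ψ₁ Ψ₂ (0 : Matrix κ₂ κ₁ ℤ)).ker : ℤ) with hb'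
      have hθ : θ = ((a : ℤ) : ℝ) • θh + ((b' : ℤ) : ℝ) • θv := by
        rw [hrep', hb', Int.cast_sub, Int.cast_natCast, sub_smul, one_smul]
        abel
      obtain ⟨ha, hb⟩ := (hamp a b').1 (hθ ▸ hR)
      have hQ' := (hQ (a : ℝ) (b' : ℝ)).1
      rw [← hθ, hQθ] at hQ'
      have hab : (a : ℝ) * b' = d := by linarith
      have habZ : a * b' = (d : ℤ) := by exact_mod_cast hab
      obtain ⟨a', rfl⟩ := Int.eq_ofNat_of_zero_le ha.le
      obtain ⟨b'', hb''⟩ := Int.eq_ofNat_of_zero_le hb.le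
      rw [hb''] at habZ hθ hb
      have habN : a' * b'' = d := by exact_mod_cast habZ
      have ha' : 0 < a' := by exact_mod_cast ha
      have hd : d ≠ 0 := by
        rw [← habN]; exact Nat.mul_ne_zero ha'.ne' (by exact_mod_cast hb.ne' : b'' ≠ 0)
      refine ⟨a', ⟨⟨b'', habN.symm⟩, hd⟩, ?_⟩
      rw [hθ, hφ]
      simp only
      rw [← habN, Nat.mul_div_cancel_left b'' ha']
    · rintro ⟨k, ⟨hk, hd⟩, rfl⟩
      have hk0 : 0 < k := Nat.pos_of_dvd_of_pos hk (Nat.pos_of_ne_zero hd)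
      have hdk : 0 < d / k := Nat.div_pos (Nat.le_of_dvd (Nat.pos_of_ne_zero hd) hk) hk0
      refine ⟨(hamp (k : ℤ) ((d / k : ℕ) : ℤ)).2 ⟨by exact_mod_cast hk0, by exact_mod_cast hdk⟩, ?_⟩
      rw [hφ]
      simp only
      rw [(hQ ((k : ℤ) : ℝ) (((d / k : ℕ) : ℤ) : ℝ)).1, Int.cast_natCast, Int.cast_natCast,
        Nat.cast_div hk (by exact_mod_cast hk0.ne'), mul_div_cancel₀ _ (by exact_mod_cast hk0.ne')]
  have hinj : Set.InjOn φ (Nat.divisors d : Set ℕ) := by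
    intro k _ k' _ hkk'
    have h1 := (hQ ((k : ℤ) : ℝ) (((d / k : ℕ) : ℤ) : ℝ)).2.2.1
    have h2 := (hQ ((k' : ℤ) : ℝ) (((d / k' : ℕ) : ℤ) : ℝ)).2.2.1
    have hφk : φ k = φ k' := hkk'
    simp only [hφ] at hφk
    rw [hφk] at h1
    have h : ((k : ℤ) : ℝ) = ((k' : ℤ) : ℝ) := h1.symm.trans h2
    exact_mod_cast h
  rw [hS, hinj.ncard_image, Set.ncard_coe_finset]

/-! ## §3 Rosen–Shnidman §4: the classes `ah + bX_λ + cv` — `d = ac − b²m`, `det = 2m`, Lemma 4.1 -/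

include he hZh hZv hθh hθv hZΓ hθΓ in
/-- **`L = ah + bX_λ + cv`: `L · h = c`, `L · v = a`, `L · X_λ = -2bm`, `L · (h + v) = a + c`** (`m = deg λ`;
`L² = 2(ac - b²m)` is file 84's `intersectionForm_self_smul_add_smul_graph_sub_add_smul`).
[cite: RosenShnidman2014NeronSeveriProductSurfaces, §4 ("The class `X_λ` is orthogonal to `h` and `v`", "`d = ½(L.L) = ac − b²m`")] -/
theorem intersectionForm_smul_add_smul_graph_sub_add_smul (a b c : ℝ) :
    intersectionForm (g := 2) (prodPeriodL2 Ψ₁ Ψ₂) e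
        (a • θh + b • (θΓ - θh - (Nat.card (mapMatrixHom Ψ₁ Ψ₂ A).ker : ℝ) • θv) + c • θv) θh = c ∧
      intersectionForm (g := 2) (prodPeriodL2 Ψ₁ Ψ₂) e
        (a • θh + b • (θΓ - θh - (Nat.card (mapMatrixHom Ψ₁ Ψ₂ A).ker : ℝ) • θv) + c • θv) θv = a ∧
      intersectionForm (g := 2) (prodPeriodL2 Ψ₁ Ψ₂) e
        (a • θh + b • (θΓ - θh - (Nat.card (mapMatrixHom Ψ₁ Ψ₂ A).ker : ℝ) • θv) + c • θv)
        (θΓ - θh - (Nat.card (mapMatrixHom Ψ₁ Ψ₂ A).ker : ℝ) • θv) = -2 * b * Nat.card (mapMatrixHom Ψ₁ Ψ₂ A).ker ∧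
      intersectionForm (g := 2) (prodPeriodL2 Ψ₁ Ψ₂) e
        (a • θh + b • (θΓ - θh - (Nat.card (mapMatrixHom Ψ₁ Ψ₂ A).ker : ℝ) • θv) + c • θv) (θh + θv) = a + c := by
  obtain ⟨hhh, hvv, hhv⟩ := intersectionForm_axes Ψ₁ Ψ₂ e he Zh Zv hZh hZv ah av hθh hθv
  obtain ⟨hXh, hXv, hXX⟩ := intersectionForm_graph_sub_sub_smul Ψ₁ Ψ₂ e he Zh Zv hZh hZv ah av hθh hθv A ZΓ hZΓ aΓ hθΓ
  have hvh : intersectionForm (g := 2) (prodPeriodL2 Ψ₁ Ψ₂) e θv θh = 1 := by rw [intersectionForm_comm _ even_two e, hhv]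
  set X := θΓ - θh - (Nat.card (mapMatrixHom Ψ₁ Ψ₂ A).ker : ℝ) • θv with hX
  have hhX : intersectionForm (g := 2) (prodPeriodL2 Ψ₁ Ψ₂) e θh X = 0 := by rw [intersectionForm_comm _ even_two e, hXh]
  have hvX : intersectionForm (g := 2) (prodPeriodL2 Ψ₁ Ψ₂) e θv X = 0 := by rw [intersectionForm_comm _ even_two e, hXv]
  simp only [map_add, map_smul, LinearMap.add_apply, LinearMap.smul_apply, smul_eq_mul, hhh, hvv, hhv, hvh, hXh, hXv,
    hXX, hhX, hvX]
  refine ⟨by ring, by ring, by ring, by ring⟩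

include he hZh hZv hθh hθv hZΓ hθΓ in
/-- **"The determinant of the intersection pairing on `NS(A)` is equal to `2m`"**: the Gram matrix of `h, X_λ, v` is
`[[0, 0, 1], [0, -2m, 0], [1, 0, 0]]`, of determinant `2m` (`m = deg λ`; for `ρ(A) = 3` and `λ` a cyclic isogeny of
minimal degree these three classes are a `ℤ`-basis of `NS(A)`, file 84 `isNSForm_iff_exists_rosenShnidman`).
[cite: RosenShnidman2014NeronSeveriProductSurfaces, §4 ("the determinant of the intersection pairing on `NS(A)` is equal to `2m`")] -/
theorem det_gram_axes_graph_sub :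
    (Matrix.of ![
      ![intersectionForm (g := 2) (prodPeriodL2 Ψ₁ Ψ₂) e θh θh,
        intersectionForm (g := 2) (prodPeriodL2 Ψ₁ Ψ₂) e θh (θΓ - θh - (Nat.card (mapMatrixHom Ψ₁ Ψ₂ A).ker : ℝ) • θv),
        intersectionForm (g := 2) (prodPeriodL2 Ψ₁ Ψ₂) e θh θv],
      ![intersectionForm (g := 2) (prodPeriodL2 Ψ₁ Ψ₂) e (θΓ - θh - (Nat.card (mapMatrixHom Ψ₁ Ψ₂ A).ker : ℝ) • θv) θh,
        intersectionForm (g := 2) (prodPeriodL2 Ψ₁ Ψ₂) e (θΓ - θh - (Nat.card (mapMatrixHom Ψ₁ Ψ₂ A).ker : ℝ) • θv)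
          (θΓ - θh - (Nat.card (mapMatrixHom Ψ₁ Ψ₂ A).ker : ℝ) • θv),
        intersectionForm (g := 2) (prodPeriodL2 Ψ₁ Ψ₂) e (θΓ - θh - (Nat.card (mapMatrixHom Ψ₁ Ψ₂ A).ker : ℝ) • θv) θv],
      ![intersectionForm (g := 2) (prodPeriodL2 Ψ₁ Ψ₂) e θv θh,
        intersectionForm (g := 2) (prodPeriodL2 Ψ₁ Ψ₂) e θv (θΓ - θh - (Nat.card (mapMatrixHom Ψ₁ Ψ₂ A).ker : ℝ) • θv),
        intersectionForm (g := 2) (prodPeriodL2 Ψ₁ Ψ₂) e θv θv]]).det =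
      2 * Nat.card (mapMatrixHom Ψ₁ Ψ₂ A).ker := by
  obtain ⟨hhh, hvv, hhv⟩ := intersectionForm_axes Ψ₁ Ψ₂ e he Zh Zv hZh hZv ah av hθh hθv
  obtain ⟨hXh, hXv, hXX⟩ := intersectionForm_graph_sub_sub_smul Ψ₁ Ψ₂ e he Zh Zv hZh hZv ah av hθh hθv A ZΓ hZΓ aΓ hθΓ
  have hvh : intersectionForm (g := 2) (prodPeriodL2 Ψ₁ Ψ₂) e θv θh = 1 := by rw [intersectionForm_comm _ even_two e, hhv]
  have hhX : intersectionForm (g := 2) (prodPeriodL2 Ψ₁ Ψ₂) e θh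
      (θΓ - θh - (Nat.card (mapMatrixHom Ψ₁ Ψ₂ A).ker : ℝ) • θv) = 0 := by rw [intersectionForm_comm _ even_two e, hXh]
  have hvX : intersectionForm (g := 2) (prodPeriodL2 Ψ₁ Ψ₂) e θv
      (θΓ - θh - (Nat.card (mapMatrixHom Ψ₁ Ψ₂ A).ker : ℝ) • θv) = 0 := by rw [intersectionForm_comm _ even_two e, hXv]
  rw [hhh, hvv, hhv, hvh, hXh, hXv, hXX, hhX, hvX, Matrix.det_fin_three]
  simp only [Matrix.of_apply, Matrix.cons_val_zero, Matrix.cons_val_one, Matrix.cons_val_two, Matrix.head_cons,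
    Matrix.tail_cons]
  ring

include he hθh hθv hθΓ in
/-- `ah + bX_λ + cv ∈ NS(E × E')` for integers `a, b, c`. [cite: RosenShnidman2014NeronSeveriProductSurfaces, §4 ("`L ≡ ah + bX_λ + cv ∈ NS(A_m)`")] -/
theorem isNSForm_smul_add_smul_graph_sub_add_smul (a b c : ℤ) :
    IsNSForm (prodPeriodL2 Ψ₁ Ψ₂)
      ((a : ℝ) • θh + (b : ℝ) • (θΓ - θh - (Nat.card (mapMatrixHom Ψ₁ Ψ₂ A).ker : ℝ) • θv) + (c : ℝ) • θv) := by
  have hh := isNSForm_of_analyticCycleClass_eq₈₅ Ψ₁ Ψ₂ e he Zh ah hθh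
  have hv := isNSForm_of_analyticCycleClass_eq₈₅ Ψ₁ Ψ₂ e he Zv av hθv
  have hΓ := isNSForm_of_analyticCycleClass_eq₈₅ Ψ₁ Ψ₂ e he ZΓ aΓ hθΓ
  have hX : IsNSForm (prodPeriodL2 Ψ₁ Ψ₂) (θΓ - θh - (Nat.card (mapMatrixHom Ψ₁ Ψ₂ A).ker : ℝ) • θv) := by
    have h := isNSForm_int_smul_add₈₅ Ψ₁ Ψ₂ hΓ hh hv 1 (-1) (-(Nat.card (mapMatrixHom Ψ₁ Ψ₂ A).ker : ℤ))
    simp only [Int.cast_one, one_smul, Int.cast_neg, Int.cast_natCast, neg_smul, one_smul] at h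
    rwa [sub_eq_add_neg, sub_eq_add_neg]
  exact isNSForm_int_smul_add₈₅ Ψ₁ Ψ₂ hh hX hv a b c

omit [Fintype κ₁] [Fintype κ₂] [DecidableEq κ₁] [DecidableEq κ₂] [NormedAddCommGroup F₁] [InnerProductSpace ℂ F₁]
  [FiniteDimensional ℂ F₁] [MeasurableSpace F₁] [BorelSpace F₁] [NormedAddCommGroup F₂] [InnerProductSpace ℂ F₂]
  [FiniteDimensional ℂ F₂] [MeasurableSpace F₂] [BorelSpace F₂] in
/-- The arithmetic of Lemma 4.1: for `m ≥ 0`, `ac - b²m > 0 ∧ a + c > 0 ⟺ ac - b²m > 0 ∧ a > 0 ∧ c > 0`.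
[cite: RosenShnidman2014NeronSeveriProductSurfaces, §4 Lemma 4.1 (proof: "This follows from Proposition (nakai)")] -/
private theorem lemma41_arith₈₅ (a b c : ℤ) (m : ℕ) :
    (0 < a * c - b ^ 2 * m ∧ 0 < a + c) ↔ (0 < a * c - b ^ 2 * m ∧ 0 < a ∧ 0 < c) := by
  constructor
  · rintro ⟨hd, hs⟩
    have hbm : 0 ≤ b ^ 2 * (m : ℤ) := by positivity
    have hac : 0 < a * c := by linarith
    rcases lt_trichotomy a 0 with ha | ha | ha
    · have hc : c < 0 := by
        by_contra hc; push Not at hc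
        nlinarith
      omega
    · subst ha; simp at hac
    · exact ⟨hd, ha, pos_of_mul_pos_right hac ha.le⟩
  · rintro ⟨hd, ha, hc⟩
    exact ⟨hd, by omega⟩

include e₁ e₂ he hZh hZv hθh hθv hZΓ hθΓ in
/-- **ROSEN–SHNIDMAN LEMMA 4.1: "`L ≡ ah + bX_λ + cv` is ample if and only if `d > 0` and `a, c > 0`"**,
`d = ac - b²m`, `m = deg λ` — for EVERY homomorphism `λ : E → E'` of every product `E × E'` (the source states it on
`A_m`, `ρ = 3`, where these are all classes; the proof — Prop. 2.2 with `L² = 2(ac - b²m)`, `L · (h + v) = a + c` —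
uses only the intersection table). [cite: RosenShnidman2014NeronSeveriProductSurfaces, §4 Lemma 4.1] -/
theorem isRiemannForm_smul_add_smul_graph_sub_add_smul_iff (a b c : ℤ) :
    IsRiemannForm (prodPeriodL2 Ψ₁ Ψ₂)
        ((a : ℝ) • θh + (b : ℝ) • (θΓ - θh - (Nat.card (mapMatrixHom Ψ₁ Ψ₂ A).ker : ℝ) • θv) + (c : ℝ) • θv) ↔
      0 < a * c - b ^ 2 * Nat.card (mapMatrixHom Ψ₁ Ψ₂ A).ker ∧ 0 < a ∧ 0 < c := by
  rw [(isNSForm_smul_add_smul_graph_sub_add_smul Ψ₁ Ψ₂ e he Zh Zv ah av hθh hθv A ZΓ aΓ hθΓ a b c).isRiemannForm_iff_intersectionForm_self_pos_and_axes_pos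
      Ψ₁ Ψ₂ e₁ e₂ e he Zh Zv hZh hZv ah av hθh hθv,
    intersectionForm_self_smul_add_smul_graph_sub_add_smul Ψ₁ Ψ₂ e he Zh Zv hZh hZv ah av hθh hθv A ZΓ hZΓ aΓ hθΓ,
    (intersectionForm_smul_add_smul_graph_sub_add_smul Ψ₁ Ψ₂ e he Zh Zv hZh hZv ah av hθh hθv A ZΓ hZΓ aΓ hθΓ
      a b c).2.2.2, ← lemma41_arith₈₅]
  have h1 : (0 : ℝ) < 2 * ((a : ℝ) * c - (b : ℝ) ^ 2 * (Nat.card (mapMatrixHom Ψ₁ Ψ₂ A).ker : ℝ)) ↔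
      (0 : ℤ) < a * c - b ^ 2 * Nat.card (mapMatrixHom Ψ₁ Ψ₂ A).ker := by
    rw [mul_pos_iff_of_pos_left (by norm_num : (0 : ℝ) < 2)]
    exact ⟨fun h ↦ by exact_mod_cast h, fun h ↦ by exact_mod_cast h⟩
  have h2 : (0 : ℝ) < (a : ℝ) + c ↔ (0 : ℤ) < a + c := ⟨fun h ↦ by exact_mod_cast h, fun h ↦ by exact_mod_cast h⟩
  rw [h1, h2]

include e₁ e₂ he hZh hZv hθh hθv hZΓ hθΓ in
/-- **ROSEN–SHNIDMAN THM. 4.2 (1)–(2): "`L` is ample if and only if `q_L` is positive definite", "the discriminant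
of `q_L` is `-4m deg(L)`"** for `q_L = [am, -2bm, c]` (`q_L(y, x) = amx² - 2bmxy + cy²`, §4 below), `m = deg λ ≥ 1`
(`λ` an isogeny): positive definiteness of the binary form read as `am > 0 ∧ disc = 4b²m² - 4amc < 0`, and
`4b²m² - 4amc = -4m(ac - b²m)`. [cite: RosenShnidman2014NeronSeveriProductSurfaces, §4 Thm. 4.2 (1), (2)] -/
theorem isRiemannForm_smul_add_smul_graph_sub_add_smul_iff_posDef (hm : 0 < Nat.card (mapMatrixHom Ψ₁ Ψ₂ A).ker)
    (a b c : ℤ) :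
    (IsRiemannForm (prodPeriodL2 Ψ₁ Ψ₂)
        ((a : ℝ) • θh + (b : ℝ) • (θΓ - θh - (Nat.card (mapMatrixHom Ψ₁ Ψ₂ A).ker : ℝ) • θv) + (c : ℝ) • θv) ↔
      0 < a * Nat.card (mapMatrixHom Ψ₁ Ψ₂ A).ker ∧
        (2 * b * Nat.card (mapMatrixHom Ψ₁ Ψ₂ A).ker) ^ 2 - 4 * (a * Nat.card (mapMatrixHom Ψ₁ Ψ₂ A).ker) * c < 0) ∧
    (2 * b * (Nat.card (mapMatrixHom Ψ₁ Ψ₂ A).ker : ℤ)) ^ 2 - 4 * (a * Nat.card (mapMatrixHom Ψ₁ Ψ₂ A).ker) * c =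
      -4 * Nat.card (mapMatrixHom Ψ₁ Ψ₂ A).ker * (a * c - b ^ 2 * Nat.card (mapMatrixHom Ψ₁ Ψ₂ A).ker) := by
  refine ⟨?_, by ring⟩
  rw [isRiemannForm_smul_add_smul_graph_sub_add_smul_iff Ψ₁ Ψ₂ e₁ e₂ e he Zh Zv hZh hZv ah av hθh hθv A ZΓ hZΓ aΓ hθΓ]
  set m : ℤ := (Nat.card (mapMatrixHom Ψ₁ Ψ₂ A).ker : ℤ) with hmdef
  have hm' : (0 : ℤ) < m := by rw [hmdef]; exact_mod_cast hm
  have hid : (2 * b * m) ^ 2 - 4 * (a * m) * c = -(4 * m * (a * c - b ^ 2 * m)) := by ring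
  constructor
  · rintro ⟨hd, ha, hc⟩
    refine ⟨mul_pos ha hm', ?_⟩
    rw [hid, neg_lt_zero]
    positivity
  · rintro ⟨ham, hdisc⟩
    have ha : 0 < a := pos_of_mul_pos_left ham hm'.le
    rw [hid, neg_lt_zero] at hdisc
    have hd : 0 < a * c - b ^ 2 * m := pos_of_mul_pos_right hdisc (by positivity)
    have hb2 : 0 ≤ b ^ 2 * m := by positivity
    have hac : 0 < a * c := by linarith
    exact ⟨hd, ha, pos_of_mul_pos_right hac ha.le⟩

include e₁ e₂ he hZh hZv hθh hθv hZΓ hθΓ in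
/-- **In Rosen–Shnidman's coordinates of Prop. 2.3: `(a - 1)h + Γ_λ + (b - deg λ)v = ah + X_λ + bv` is ample iff
`ab - deg λ > 0` and `a, b > 0`.** [cite: RosenShnidman2014NeronSeveriProductSurfaces, §4 Lemma 4.1 (with `b = 1`)] -/
theorem isRiemannForm_rosenShnidman_iff (a b : ℤ) :
    IsRiemannForm (prodPeriodL2 Ψ₁ Ψ₂)
        (((a : ℝ) - 1) • θh + θΓ + ((b : ℝ) - (Nat.card (mapMatrixHom Ψ₁ Ψ₂ A).ker : ℝ)) • θv) ↔
      0 < a * b - Nat.card (mapMatrixHom Ψ₁ Ψ₂ A).ker ∧ 0 < a ∧ 0 < b := by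
  have heq : ((a : ℝ) - 1) • θh + θΓ + ((b : ℝ) - (Nat.card (mapMatrixHom Ψ₁ Ψ₂ A).ker : ℝ)) • θv =
      (a : ℝ) • θh + ((1 : ℤ) : ℝ) • (θΓ - θh - (Nat.card (mapMatrixHom Ψ₁ Ψ₂ A).ker : ℝ) • θv) + (b : ℝ) • θv := by
    simp only [Int.cast_one, one_smul, sub_smul, one_smul]
    abel
  rw [heq, isRiemannForm_smul_add_smul_graph_sub_add_smul_iff Ψ₁ Ψ₂ e₁ e₂ e he Zh Zv hZh hZv ah av hθh hθv A ZΓ hZΓ aΓ hθΓ,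
    one_pow, one_mul]

/-! ## §4 Rosen–Shnidman's quadratic form `q_L(f) = deg(f^*L)` on `Hom(E, A) ⊇ ℤ(1, 0) ⊕ ℤ(0, λ)` -/

omit [FiniteDimensional ℂ F₁] [MeasurableSpace F₁] [BorelSpace F₁] in
/-- `vol_E` is real: `vol(v) = Re vol(v)`. [cite: Lange2023AbelianVarietiesComplex, §6.2.4 p. 310] -/
private theorem volumeForm_eq_coe_re₈₅ {N : ℕ} (g : Fin N ≃ κ₁) (v : Fin N → F₁) :
    volumeForm Ψ₁ g v = (((volumeForm Ψ₁ g v).re : ℝ) : ℂ) := by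
  rw [volumeForm_apply, Complex.ofReal_re]

include he₁ he₂ he hZh hθh hZv hθv hA hZΓ hθΓ in
/-- **`f^*L` for `f = ([y], xλ) : E → E × E'` and `L = ah + bX_λ + cv`, pointwise**: with `f(z) = (yz, xλ(z))`
(real-linear lift `u ↦ (y u, x L u)`), `(f^*L)(u, w) = -(amx² - 2bmxy + cy²) · Re vol_E(u, w)`, `m = deg λ` — from
the pointwise classes of file 84 (`θ_h = -Re pr₂^*vol_{E'}`, `θ_v = -Re pr₁^*vol_E`, `X_λ(p, q) = Re vol_{E'}(L p₁, q₂)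
- Re vol_{E'}(L q₁, p₂)`) and `λ^*vol_{E'} = m · vol_E`. [cite: RosenShnidman2014NeronSeveriProductSurfaces, §4 ("one computes `q_L([y], xλ) = amx² − 2bmxy + cy²`")] -/
theorem smul_add_smul_graph_sub_add_smul_comp_apply (a b c x y : ℝ) {f : F₁ →L[ℝ] WithLp 2 (F₁ × F₂)}
    (hf : ∀ u, f u = toLp 2 (y • u, x • L u)) (u w : F₁) :
    ((a • θh + b • (θΓ - θh - (Nat.card (mapMatrixHom Ψ₁ Ψ₂ A).ker : ℝ) • θv) + c • θv).compContinuousLinearMap f)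
        ![u, w] =
      -((a * Nat.card (mapMatrixHom Ψ₁ Ψ₂ A).ker * x ^ 2 - 2 * b * Nat.card (mapMatrixHom Ψ₁ Ψ₂ A).ker * x * y +
        c * y ^ 2) * (volumeForm Ψ₁ e₁ ![u, w]).re) := by
  have hθh' := apply_of_carrier_eq_setOf_snd_eq_zero Ψ₁ Ψ₂ e₁ he₁ e₂ he₂ e he Zh hZh ah hθh
  have hθv' := apply_of_carrier_eq_setOf_fst_eq_zero Ψ₁ Ψ₂ e₁ he₁ e₂ he₂ e he Zv hZv av hθv
  have hX := graph_sub_sub_smul_apply Ψ₁ Ψ₂ e₁ he₁ e₂ he₂ e he Zh Zv hZh hZv ah av hθh hθv hA ZΓ hZΓ aΓ hθΓ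
  have hfu1 : ∀ u, (ofLp (f u)).1 = y • u := fun u ↦ by rw [hf]
  have hfu2 : ∀ u, (ofLp (f u)).2 = x • L u := fun u ↦ by rw [hf]
  rw [ContinuousAlternatingMap.compContinuousLinearMap_apply]
  have hv : (⇑f ∘ ![u, w]) = ![f u, f w] := by funext i; fin_cases i <;> rfl
  rw [hv]
  simp only [ContinuousAlternatingMap.add_apply, ContinuousAlternatingMap.smul_apply, smul_eq_mul]
  rw [hθh', hθv', hX]
  have e2 : (fun i ↦ (ofLp (![f u, f w] i)).2) = ![x • L u, x • L w] := by
    funext i; fin_cases i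
    · exact hfu2 u
    · exact hfu2 w
  have e1 : (fun i ↦ (ofLp (![f u, f w] i)).1) = ![y • u, y • w] := by
    funext i; fin_cases i
    · exact hfu1 u
    · exact hfu1 w
  rw [e2, e1, hfu1, hfu1, hfu2, hfu2, L.map_smul_of_tower, L.map_smul_of_tower,
    pair_smul_left₈₅ (volumeForm Ψ₂ e₂) x (L u) (x • L w), pair_smul_right₈₅ (volumeForm Ψ₂ e₂) x (L u) (L w),
    pair_smul_left₈₅ (volumeForm Ψ₁ e₁) y u (y • w), pair_smul_right₈₅ (volumeForm Ψ₁ e₁) y u w,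
    pair_smul_left₈₅ (volumeForm Ψ₂ e₂) y (L u) (x • L w), pair_smul_right₈₅ (volumeForm Ψ₂ e₂) x (L u) (L w),
    pair_smul_left₈₅ (volumeForm Ψ₂ e₂) y (L w) (x • L u), pair_smul_right₈₅ (volumeForm Ψ₂ e₂) x (L w) (L u),
    pair_swap₈₅ (volumeForm Ψ₂ e₂) (L w) (L u), volumeForm_apply_pair_map_eq_natCard_mul Ψ₁ Ψ₂ e₁ e₂ hA u w,
    volumeForm_eq_coe_re₈₅ Ψ₁ e₁ ![u, w]]
  simp only [Complex.real_smul, Complex.neg_re, Complex.mul_re, Complex.ofReal_re, Complex.ofReal_im,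
    Complex.natCast_re, Complex.natCast_im, mul_zero, sub_zero, zero_mul]
  ring

include he₁ he₂ he hZh hθh hZv hθv hA hZΓ hθΓ in
/-- **ROSEN–SHNIDMAN'S QUADRATIC FORM: `c₁(f^*L) = q_L(f) · [pt]` with `q_L([y], xλ) = amx² - 2bmxy + cy²`**
for `L = ah + bX_λ + cv` and `f = ([y], xλ) ∈ Hom(E, E) ⊕ Hom(E, E') = Hom(E, E × E')` (`m = deg λ`): the class
`ofRealForm(-(f^*L))` of the pulled-back bundle is `q_L(f)` times the point class `vol_E` of `E`
(`analyticCycleClass_singleton_eq_volumeForm`), i.e. `deg(f^*L) = q_L(f)`.  (Stated for the real-linear lift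
`u ↦ (y u, x L u)` with any real `x, y`; for integers it is the analytic representation of `([y], xλ)`.)
[cite: RosenShnidman2014NeronSeveriProductSurfaces, §4 ("`q_L : Hom(E, A_m) → ℤ`, `f ↦ deg(f^*L)` … `q_L([y], xλ) = amx² − 2bmxy + cy²`")] -/
theorem ofRealForm_neg_smul_add_smul_graph_sub_add_smul_comp (a b c x y : ℝ) {f : F₁ →L[ℝ] WithLp 2 (F₁ × F₂)}
    (hf : ∀ u, f u = toLp 2 (y • u, x • L u)) :
    ofRealForm (-((a • θh + b • (θΓ - θh - (Nat.card (mapMatrixHom Ψ₁ Ψ₂ A).ker : ℝ) • θv) + c • θv).compContinuousLinearMap f)) =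
      ((a * Nat.card (mapMatrixHom Ψ₁ Ψ₂ A).ker * x ^ 2 - 2 * b * Nat.card (mapMatrixHom Ψ₁ Ψ₂ A).ker * x * y +
        c * y ^ 2 : ℝ) : ℂ) • volumeForm Ψ₁ e₁ := by
  ext v
  rw [ofRealForm_apply, ContinuousAlternatingMap.neg_apply, apply_eq_pair₈₅ _ v,
    smul_add_smul_graph_sub_add_smul_comp_apply Ψ₁ Ψ₂ e₁ he₁ e₂ he₂ e he Zh Zv hZh hZv ah av hθh hθv A hA ZΓ hZΓ aΓ hθΓ
      a b c x y hf, neg_neg, ContinuousAlternatingMap.smul_apply, smul_eq_mul]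
  have hv : volumeForm Ψ₁ e₁ v = volumeForm Ψ₁ e₁ ![v 0, v 1] := by congr 1; funext i; fin_cases i <;> rfl
  rw [hv, volumeForm_eq_coe_re₈₅ Ψ₁ e₁ ![v 0, v 1], Complex.ofReal_re, ← Complex.ofReal_mul]

include he₁ he₂ he hZh hθh hZv hθv hA hZΓ hθΓ in
/-- **`deg(f^*L) = ∫_E c₁(f^*L) = q_L(f) = amx² - 2bmxy + cy²`** (`∫_E vol_E = 1`).
[cite: RosenShnidman2014NeronSeveriProductSurfaces, §4 ("`f ↦ deg(f^*L)`", "`q_L([y], xλ) = amx² − 2bmxy + cy²`")] -/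
theorem torusIntegral_ofRealForm_neg_smul_add_smul_graph_sub_add_smul_comp (a b c x y : ℝ)
    {f : F₁ →L[ℝ] WithLp 2 (F₁ × F₂)} (hf : ∀ u, f u = toLp 2 (y • u, x • L u)) :
    torusIntegral Ψ₁ e₁ (ofRealForm
        (-((a • θh + b • (θΓ - θh - (Nat.card (mapMatrixHom Ψ₁ Ψ₂ A).ker : ℝ) • θv) + c • θv).compContinuousLinearMap f))) =
      ((a * Nat.card (mapMatrixHom Ψ₁ Ψ₂ A).ker * x ^ 2 - 2 * b * Nat.card (mapMatrixHom Ψ₁ Ψ₂ A).ker * x * y +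
        c * y ^ 2 : ℝ) : ℂ) := by
  rw [ofRealForm_neg_smul_add_smul_graph_sub_add_smul_comp Ψ₁ Ψ₂ e₁ he₁ e₂ he₂ e he Zh Zv hZh hZv ah av hθh hθv A hA ZΓ
      hZΓ aΓ hθΓ a b c x y hf, torusIntegral_smul, torusIntegral_volumeForm, mul_one]

omit [DecidableEq κ₁] [DecidableEq κ₂] [FiniteDimensional ℂ F₁] [MeasurableSpace F₁] [BorelSpace F₁] [FiniteDimensional ℂ F₂]
  [MeasurableSpace F₂] [BorelSpace F₂] in
include hA in
/-- **The lift `u ↦ (y u, x L u)` exists** (it is `ℝ`-linear and continuous; for integers `x, y` it maps `Λ_E` into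
`Λ_E ⊕ Λ_{E'}`, the analytic representation of `([y], xλ) : E → E × E'`). [cite: RosenShnidman2014NeronSeveriProductSurfaces, §4 ("the natural basis `{(1,0), (0,λ)}` for `Hom(E, A_m) = Hom(E, E) ⊕ Hom(E, E')`")] -/
theorem exists_clm_apply_eq_toLp_smul (x y : ℤ) :
    ∃ f : F₁ →L[ℝ] WithLp 2 (F₁ × F₂), (∀ u, f u = toLp 2 ((y : ℝ) • u, (x : ℝ) • L u)) ∧
      ∀ n : κ₁ → ℤ, ∃ n' : κ₁ ⊕ κ₂ → ℤ, f (latticeVec Ψ₁ n) = latticeVec (prodPeriodL2 Ψ₁ Ψ₂) n' := by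
  refine ⟨((WithLp.prodContinuousLinearEquiv 2 ℝ F₁ F₂).symm : F₁ × F₂ →L[ℝ] WithLp 2 (F₁ × F₂)).comp
      (((y : ℝ) • ContinuousLinearMap.id ℝ F₁).prod ((x : ℝ) • L.restrictScalars ℝ)), fun u ↦ rfl, fun n ↦ ?_⟩
  refine ⟨Sum.elim (y • n) (x • A.mulVec n), ?_⟩
  change toLp 2 ((y : ℝ) • latticeVec Ψ₁ n, (x : ℝ) • L (latticeVec Ψ₁ n)) =
    toLp 2 (latticeVec Ψ₁ (y • n), latticeVec Ψ₂ (x • A.mulVec n))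
  congr 1
  refine Prod.ext ?_ ?_
  · change (y : ℝ) • latticeVec Ψ₁ n = latticeVec Ψ₁ (y • n)
    rw [latticeVec, latticeVec, ← map_smul]
    congr 1
    funext i
    simp
  · change (x : ℝ) • L (latticeVec Ψ₁ n) = latticeVec Ψ₂ (x • A.mulVec n)
    rw [latticeVec, latticeVec, ← hA, ← map_smul]
    congr 1
    funext i
    simp [Matrix.mulVec, dotProduct, Matrix.map_apply, Finset.mul_sum]

end Setting

end ComplexTorus

end Literature.Geometry.Kaehler
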